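import Summits.Schanuel.Schanuel.Theses.RigidCore
import Literature.NumberTheory.Transcendental.ExpPointsExamples
import Literature.NumberTheory.Transcendental.TrdegZariskiDim

/-!
# drefute g2 — stub signatures of line `cusp-germ-schneider-sparsity` (skeleton sha 1933dd98…, reshape 1)
copied VERBATIM from `Cruxes/SparsityTwo/Lines/cusp-germ-schneider-sparsity.lean`, and the
kernel-checked fact that the three `W`-stubs (E), (H), (★) are consequences of `SchanuelRank 2`
(SC(2)), via the landed `indepExpPoints_eq_empty_of_schanuelRank_two` (TrdegZariskiDim, p72297).
Consequence for refuters: no UNCONDITIONAL `stub_false` can exist for E, H, ★ (any counterexample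
refutes Schanuel's conjecture); the only field-blind, cheaply refutable open stub is (S).
-/

namespace Summit.Schanuel.Schanuel.Cruxes.SparsityTwo.DrefuteG2

open Filter Topology Complex Polynomial Literature.NumberTheory.Transcendental
open scoped Real

set_option linter.dupNamespace false

noncomputable section

/-- Registered signature of `stub_cuspEscape` (E), verbatim. -/
def StubCuspEscape : Prop :=
    ∀ (W : Set (Fin 2 ⊕ Fin 2 → ℂ)), IsDefinedOver (⊥ : Subfield ℂ) W → zariskiDim ℂ W < 2 →
      (indepExpPoints W).Infinite →
      (∃ (s : Fin 2 ≃ Fin 2) (e : ℕ) (A : Polynomial ℂ) (g ℓu ℓv : ℂ → ℂ) (ρ : ℝ),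
        let w : ℕ → ℂ := fun N => (((N : ℝ) ^ ((e : ℝ)⁻¹) : ℝ) : ℂ);
        let x : ℕ → Fin 2 → ℂ := fun N =>
          (![2 * ↑π * I * (N : ℂ) + ℓu (w N)⁻¹,
              2 * ↑π * I * (A.eval (w N) + g (w N)⁻¹) + ℓv (w N)⁻¹] : Fin 2 → ℂ) ∘ s;
        let y : ℕ → Fin 2 → ℂ := fun N =>
          (![Complex.exp (ℓu (w N)⁻¹), Complex.exp (ℓv (w N)⁻¹)] : Fin 2 → ℂ) ∘ s;
        0 < e ∧ 0 < ρ ∧ AnalyticAt ℂ g 0 ∧ g 0 = 0 ∧ AnalyticAt ℂ ℓu 0 ∧ AnalyticAt ℂ ℓv 0 ∧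
        (¬ ∃ P : MvPolynomial (Fin 2) ℂ, P ≠ 0 ∧
            ∀ᶠ z in 𝓝 (0 : ℂ), MvPolynomial.eval ![z, g z] P = 0) ∧
        (∀ σ : ℂ, 0 < ‖σ‖ → ‖σ‖ < ρ →
          Sum.elim ((![2 * ↑π * I * σ⁻¹ ^ e + ℓu σ,
                        2 * ↑π * I * (A.eval σ⁻¹ + g σ) + ℓv σ] : Fin 2 → ℂ) ∘ s)
            ((![Complex.exp (ℓu σ), Complex.exp (ℓv σ)] : Fin 2 → ℂ) ∘ s) ∈ W) ∧
        Set.Infinite {N : ℕ | x N ∈ indepExpPoints W ∧ Complex.exp ∘ x N = y N ∧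
          ∃ L : ℤ, A.eval (w N) + g (w N)⁻¹ = L}) ∨
      (∃ a b : ℤ, (a ≠ 0 ∨ b ≠ 0) ∧ ∃ c : ℂ,
        Set.Infinite {x : Fin 2 → ℂ | x ∈ indepExpPoints W ∧ (a : ℂ) * x 0 + (b : ℂ) * x 1 = c}) ∨
      (∃ ω : Fin 2 → ℂ,
        Set.Infinite {x : Fin 2 → ℂ | x ∈ indepExpPoints W ∧ Complex.exp ∘ x = ω})

/-- Registered signature of `stub_classicalClassesFinite` (H), verbatim. -/
def StubClassicalClassesFinite : Prop :=
    ∀ (W : Set (Fin 2 ⊕ Fin 2 → ℂ)), IsDefinedOver (⊥ : Subfield ℂ) W → zariskiDim ℂ W < 2 →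
      (∀ a b : ℤ, (a ≠ 0 ∨ b ≠ 0) → ∀ c : ℂ,
        Set.Finite {x : Fin 2 → ℂ | x ∈ indepExpPoints W ∧ (a : ℂ) * x 0 + (b : ℂ) * x 1 = c}) ∧
      (∀ ω : Fin 2 → ℂ,
        Set.Finite {x : Fin 2 → ℂ | x ∈ indepExpPoints W ∧ Complex.exp ∘ x = ω})

/-- Registered signature of `stub_cuspZeroLogDensity` (S), verbatim. -/
def StubCuspZeroLogDensity : Prop :=
    ∀ (e : ℕ), 0 < e → ∀ (A : Polynomial ℂ) (g : ℂ → ℂ), AnalyticAt ℂ g 0 → g 0 = 0 →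
      (¬ ∃ P : MvPolynomial (Fin 2) ℂ, P ≠ 0 ∧
          ∀ᶠ z in 𝓝 (0 : ℂ), MvPolynomial.eval ![z, g z] P = 0) →
      ∀ ε : ℝ, 0 < ε → ∃ᶠ X : ℕ in atTop,
        (Nat.card {N : ℕ | N ≤ X ∧ ∃ L : ℤ,
            A.eval ((((N : ℝ) ^ ((e : ℝ)⁻¹) : ℝ) : ℂ)) +
              g ((((N : ℝ) ^ ((e : ℝ)⁻¹) : ℝ) : ℂ))⁻¹ = L} : ℝ) ≤ ε * Real.log X

/-- Registered signature of `stub_realArithmeticCuspFinite` (★), verbatim. -/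
def StubRealArithmeticCuspFinite : Prop :=
    ∀ (W : Set (Fin 2 ⊕ Fin 2 → ℂ)), IsDefinedOver (⊥ : Subfield ℂ) W → zariskiDim ℂ W < 2 →
      ∀ (s : Fin 2 ≃ Fin 2) (e : ℕ) (A : Polynomial ℂ) (g ℓu ℓv : ℂ → ℂ) (ρ : ℝ),
        let w : ℕ → ℂ := fun N => (((N : ℝ) ^ ((e : ℝ)⁻¹) : ℝ) : ℂ);
        let x : ℕ → Fin 2 → ℂ := fun N =>
          (![2 * ↑π * I * (N : ℂ) + ℓu (w N)⁻¹,
              2 * ↑π * I * (A.eval (w N) + g (w N)⁻¹) + ℓv (w N)⁻¹] : Fin 2 → ℂ) ∘ s;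
        let y : ℕ → Fin 2 → ℂ := fun N =>
          (![Complex.exp (ℓu (w N)⁻¹), Complex.exp (ℓv (w N)⁻¹)] : Fin 2 → ℂ) ∘ s;
        0 < e → 0 < ρ → AnalyticAt ℂ g 0 → g 0 = 0 → AnalyticAt ℂ ℓu 0 → AnalyticAt ℂ ℓv 0 →
        (¬ ∃ P : MvPolynomial (Fin 2) ℂ, P ≠ 0 ∧
            ∀ᶠ z in 𝓝 (0 : ℂ), MvPolynomial.eval ![z, g z] P = 0) →
        (∀ σ : ℂ, 0 < ‖σ‖ → ‖σ‖ < ρ →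
          Sum.elim ((![2 * ↑π * I * σ⁻¹ ^ e + ℓu σ,
                        2 * ↑π * I * (A.eval σ⁻¹ + g σ) + ℓv σ] : Fin 2 → ℂ) ∘ s)
            ((![Complex.exp (ℓu σ), Complex.exp (ℓv σ)] : Fin 2 → ℂ) ∘ s) ∈ W) →
        (¬ ∃ (q : Polynomial ℚ) (c : ℂ), ∀ N : ℕ,
            A.eval (w N) = (q.map (algebraMap ℚ ℂ)).eval (N : ℂ) + c) →
        ((∀ k : ℕ, (A.coeff k).im = 0) ∧ ∀ᶠ t : ℝ in 𝓝[>] 0, (g (t : ℂ)).im = 0) →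
        (∀ ε : ℝ, 0 < ε → ∃ᶠ X : ℕ in atTop,
          (Nat.card {N : ℕ | N ≤ X ∧ ∃ L : ℤ, A.eval (w N) + g (w N)⁻¹ = L} : ℝ)
            ≤ ε * Real.log X) →
        Set.Finite {N : ℕ | x N ∈ indepExpPoints W ∧ Complex.exp ∘ x N = y N ∧
          ∃ L : ℤ, A.eval (w N) + g (w N)⁻¹ = L}

/-- (E) is a theorem of SC(2): its hypothesis `(indepExpPoints W).Infinite` is SC(2)-false. -/
theorem stubCuspEscape_of_schanuelRank_two (h : SchanuelRank 2) : StubCuspEscape := by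
  intro W hW hdim hinf
  exact ((sparsity_of_schanuelRank_two h W hW hdim).not_infinite hinf).elim

/-- (H) is a theorem of SC(2): both counted sets are subsets of `indepExpPoints W`. -/
theorem stubClassicalClassesFinite_of_schanuelRank_two (h : SchanuelRank 2) :
    StubClassicalClassesFinite := by
  intro W hW hdim
  exact ⟨fun a b _ c => (sparsity_of_schanuelRank_two h W hW hdim).subset fun x hx => hx.1,
    fun ω => (sparsity_of_schanuelRank_two h W hW hdim).subset fun x hx => hx.1⟩

/-- (★) is a theorem of SC(2): the ray hits are indexed injectively-enough by points of
`indepExpPoints W`, which SC(2) empties; formally the counted set of `N` is empty. -/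
theorem stubRealArithmeticCuspFinite_of_schanuelRank_two (h : SchanuelRank 2) :
    StubRealArithmeticCuspFinite := by
  intro W hW hdim s e A g ℓu ℓv ρ w x y he hρ hg hg0 hu hv htr hbr hrat hreal hlac
  have h0 := indepExpPoints_eq_empty_of_schanuelRank_two h hW hdim
  refine Set.Finite.subset Set.finite_empty fun N hN => ?_
  exact absurd hN.1 (by rw [h0]; exact Set.notMem_empty _)

end

end Summit.Schanuel.Schanuel.Cruxes.SparsityTwo.DrefuteG2
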